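import Summits.ValiantsHypothesis.ValiantsHypothesis.Theorems.PerDivisionHard.Negative.PerLowDegreeRung
import Literature.Computability.AlgebraicComplexity.MonotoneStructure

/-!
# Crux `DivisionGap.PerDivisionHard` (stmt-ValiantsHypothesis-5065), line `pair-descent-jss-endpoint` —
stub `stub_sparseRigid`, part Count: placements by counting, the generic weight, the top fibre

Vocabulary-free ingredients of `stub_sparseRigid` (K2 of the line for SPARSE cofactors); this
file does not import `Theorems/DivisionGapDefs.lean` (the block labels appear as the explicit sum
type `Fin b ⊕ ((Fin b × Fin b × Fin k) ⊕ Fin m) = BlockV b k m`, and "cuts out" is spelled out):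

* `stub_sparseRigid_count` / `exists_goodSubset` — **placement by counting**: if every member of
  a family `P` of "bad" row sets has at least `t₀` elements and
  `|P| · C(n - t₀, N - t₀) < C(n, N)`, some `N`-subset `R` of the rows contains no bad set
  (the `N`-subsets containing a fixed `t`-set number `C(n - t, N - t) ≤ C(n - t₀, N - t₀)`;
  union bound); `count_lt` — the inequality holds as soon as `|P| ≤ 2^{t₀}`, `t₀ ≤ N` and
  `2N + t₀ ≤ n` (`C(n,N) · C(N,t₀) = C(n,t₀) · C(n-t₀,N-t₀)` and `(N)_{t₀} ≤ N^{t₀}`,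
  `(n+1-t₀)^{t₀} ≤ (n)_{t₀}`); `growth` — the polylog bookkeeping `16 · q³ ≤ 2^L` for
  `q = (L + E + 1)^{E+1}` and large `L`.
* `exists_blockEquiv` — a labelling `BlockV b k m ≃ Fin n` putting the core and internal labels
  onto a prescribed `(b + b²k)`-set of rows.
* `genericWeight G B` — the weight `W` on `G` and `W - B^{rank e}` off `G` (`W = B^{n²}`,
  `rank = finProdFinEquiv`); `cutsOut_genericWeight` — it cuts out `G` (a permutation lies in `G`
  iff its weight is maximal) as soon as some permutation lies inside `G`;
  `eq_offG_of_mem_support_topComponent` — for `B = deg h + 1`, two monomials of the same degree in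
  the top fibre `topComponent (genericWeight G B) h` AGREE OFF `G` (the weight of a monomial `m`
  of `h` is `W · deg m - Σ_{e ∉ G} B^{rank e} m e`, and base-`B` digit vectors are determined by
  their value, `eq_of_sum_mul_pow_eq`); torus-homogeneous `h` are homogeneous
  (`degree_eq_of_rowDegrees_eq`).
* `rowDegrees_apply`, `colDegrees_apply` — row and column margins as sums.
-/

noncomputable section

-- `Summit.ValiantsHypothesis.ValiantsHypothesis.…` is the tree's mandated single-conjunct layout
-- (Sub = Summit), so the duplicated namespace component is intended.
set_option linter.dupNamespace false

namespace Summit.ValiantsHypothesis.ValiantsHypothesis.Theorems.DivisionGapPerDivisionHard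

open MvPolynomial Literature.Computability.AlgebraicComplexity
open Summit.ValiantsHypothesis.ValiantsHypothesis.Theorems.ZeroOneTransfer.Negative
open scoped NNReal

/-! ### Placement by counting -/

/-- Pascal monotonicity: `C(a, j) ≤ C(a + s, j + s)`. [folklore] -/
theorem choose_le_choose_add (a j s : ℕ) : a.choose j ≤ (a + s).choose (j + s) := by
  induction s with
  | zero => exact le_rfl
  | succ s ih =>
    calc a.choose j ≤ (a + s).choose (j + s) := ih
      _ ≤ (a + s).choose (j + s) + (a + s).choose (j + s + 1) := Nat.le_add_right _ _
      _ = (a + (s + 1)).choose (j + (s + 1)) := (Nat.choose_succ_succ (a + s) (j + s)).symm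

/-- The `N`-subsets of a finite type containing a fixed set `T` with `t₀ ≤ |T|` number at most
`C(card - t₀, N - t₀)`. [folklore] -/
theorem card_supersets_le {α : Type*} [Fintype α] [DecidableEq α] (T : Finset α) (N t₀ : ℕ)
    (ht : t₀ ≤ T.card) :
    ((Finset.univ.powersetCard N).filter fun R => T ⊆ R).card ≤
      (Fintype.card α - t₀).choose (N - t₀) := by
  by_cases hTN : T.card ≤ N
  · calc ((Finset.univ.powersetCard N).filter fun R => T ⊆ R).card
        ≤ ((Finset.univ \ T).powersetCard (N - T.card)).card := by
          refine Finset.card_le_card_of_injOn (fun R => R \ T) ?_ ?_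
          · intro R hR
            obtain ⟨hR, hTR⟩ := Finset.mem_filter.mp (Finset.mem_coe.mp hR)
            rw [Finset.mem_powersetCard] at hR
            rw [Finset.mem_coe, Finset.mem_powersetCard]
            exact ⟨Finset.sdiff_subset_sdiff (Finset.subset_univ _) le_rfl,
              by rw [Finset.card_sdiff_of_subset hTR, hR.2]⟩
          · intro R₁ h₁ R₂ h₂ h
            obtain ⟨-, hT₁⟩ := Finset.mem_filter.mp (Finset.mem_coe.mp h₁)
            obtain ⟨-, hT₂⟩ := Finset.mem_filter.mp (Finset.mem_coe.mp h₂)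
            have h' : R₁ \ T = R₂ \ T := h
            rw [← Finset.sdiff_union_of_subset hT₁, h', Finset.sdiff_union_of_subset hT₂]
      _ = (Fintype.card α - T.card).choose (N - T.card) := by
          rw [Finset.card_powersetCard, Finset.card_univ_sdiff]
      _ ≤ (Fintype.card α - t₀).choose (N - t₀) := by
          have hTα : T.card ≤ Fintype.card α := T.card_le_univ
          have := choose_le_choose_add (Fintype.card α - T.card) (N - T.card) (T.card - t₀)
          rwa [show Fintype.card α - T.card + (T.card - t₀) = Fintype.card α - t₀ by omega,
            show N - T.card + (T.card - t₀) = N - t₀ by omega] at this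
  · rw [Finset.filter_false_of_mem, Finset.card_empty]
    · exact Nat.zero_le _
    · intro R hR hTR
      rw [Finset.mem_powersetCard] at hR
      exact hTN (hR.2 ▸ Finset.card_le_card hTR)

/-- **Placement by counting.**  If every bad set has at least `t₀` elements and
`|P| · C(card - t₀, N - t₀) < C(card, N)`, some `N`-subset contains no bad set. [folklore] -/
theorem exists_goodSubset {α ι : Type*} [Fintype α] [DecidableEq α] (P : Finset ι)
    (T : ι → Finset α) (N t₀ : ℕ) (hT : ∀ p ∈ P, t₀ ≤ (T p).card)
    (hcount : P.card * (Fintype.card α - t₀).choose (N - t₀) < (Fintype.card α).choose N) :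
    ∃ R : Finset α, R.card = N ∧ ∀ p ∈ P, ¬ T p ⊆ R := by
  set U := P.biUnion fun p => (Finset.univ.powersetCard N).filter fun R => T p ⊆ R
  have hU : U.card < (Finset.univ.powersetCard N : Finset (Finset α)).card := by
    calc U.card ≤ ∑ p ∈ P, ((Finset.univ.powersetCard N).filter fun R => T p ⊆ R).card :=
          Finset.card_biUnion_le
      _ ≤ ∑ p ∈ P, (Fintype.card α - t₀).choose (N - t₀) :=
          Finset.sum_le_sum fun p hp => card_supersets_le (T p) N t₀ (hT p hp)
      _ = P.card * (Fintype.card α - t₀).choose (N - t₀) := by rw [Finset.sum_const, smul_eq_mul]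
      _ < (Fintype.card α).choose N := hcount
      _ = (Finset.univ.powersetCard N : Finset (Finset α)).card := by
          rw [Finset.card_powersetCard, Finset.card_univ]
  obtain ⟨R, hR, hRU⟩ := Finset.exists_mem_notMem_of_card_lt_card hU
  refine ⟨R, (Finset.mem_powersetCard.mp hR).2, fun p hp hTR => hRU ?_⟩
  exact Finset.mem_biUnion.mpr ⟨p, hp, Finset.mem_filter.mpr ⟨hR, hTR⟩⟩

/-- **`stub_sparseRigid`, part Count (registered sub-goal).**  Placement by counting over the rows
`Fin n`: if every bad row set has `≥ t₀` elements and `|P| · C(n - t₀, N - t₀) < C(n, N)` then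
some `N`-set of rows contains no bad set. [folklore] -/
theorem stub_sparseRigid_count :
    ∀ (n N t₀ : ℕ) (ι : Type) (P : Finset ι) (T : ι → Finset (Fin n)),
      (∀ p ∈ P, t₀ ≤ (T p).card) → P.card * (n - t₀).choose (N - t₀) < n.choose N →
      ∃ R : Finset (Fin n), R.card = N ∧ ∀ p ∈ P, ¬ T p ⊆ R := by
  intro n N t₀ ι P T hT hcount
  exact exists_goodSubset P T N t₀ hT (by simpa only [Fintype.card_fin] using hcount)

/-- The arithmetic of the union bound: `P · C(n - t₀, N - t₀) < C(n, N)` as soon as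
`P ≤ 2^{t₀}`, `0 < t₀ ≤ N` and `2N + t₀ ≤ n`. [folklore] -/
theorem count_lt {n N t₀ P : ℕ} (ht₀ : 0 < t₀) (ht₀N : t₀ ≤ N) (hP : P ≤ 2 ^ t₀)
    (h2N : 2 * N + t₀ ≤ n) : P * (n - t₀).choose (N - t₀) < n.choose N := by
  -- `P · C(N, t₀) < C(n, t₀)` via descending factorials
  have h1 : P * N.descFactorial t₀ < n.descFactorial t₀ :=
    calc P * N.descFactorial t₀ ≤ 2 ^ t₀ * N ^ t₀ :=
          Nat.mul_le_mul hP (Nat.descFactorial_le_pow N t₀)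
      _ = (2 * N) ^ t₀ := (Nat.mul_pow 2 N t₀).symm
      _ < (n + 1 - t₀) ^ t₀ := Nat.pow_lt_pow_left (by omega) (by omega)
      _ ≤ n.descFactorial t₀ := Nat.pow_sub_le_descFactorial n t₀
  have h2 : P * N.choose t₀ < n.choose t₀ := by
    rw [Nat.descFactorial_eq_factorial_mul_choose, Nat.descFactorial_eq_factorial_mul_choose,
      Nat.mul_left_comm] at h1
    exact lt_of_mul_lt_mul_left h1 (Nat.zero_le _)
  have hC : 0 < (n - t₀).choose (N - t₀) := Nat.choose_pos (by omega)
  have h3 : P * N.choose t₀ * (n - t₀).choose (N - t₀) <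
      n.choose t₀ * (n - t₀).choose (N - t₀) := mul_lt_mul_of_pos_right h2 hC
  rw [← Nat.choose_mul ht₀N, Nat.mul_right_comm] at h3
  exact lt_of_mul_lt_mul_right h3 (Nat.zero_le _)

/-! ### Polylog bookkeeping -/

/-- Polynomial versus exponential growth: `y ^ D ≤ 2 ^ y` for `y ≥ 2 ^ (2D + 3)`. [folklore] -/
theorem pow_le_two_pow (D y : ℕ) (hy : 2 ^ (2 * D + 3) ≤ y) : y ^ D ≤ 2 ^ y := by
  have hy0 : y ≠ 0 := by
    have : 1 ≤ 2 ^ (2 * D + 3) := Nat.one_le_two_pow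
    omega
  have hj : 2 * D + 3 ≤ Nat.log 2 y := Nat.le_log_of_pow_le one_lt_two hy
  have hylt : y < 2 ^ (Nat.log 2 y + 1) := Nat.lt_pow_succ_log_self one_lt_two y
  have hjy : 2 ^ Nat.log 2 y ≤ y := Nat.pow_log_le_self 2 hy0
  obtain ⟨q, hq, hjq⟩ : ∃ q, D + 2 ≤ q ∧ Nat.log 2 y = q + D + 1 :=
    ⟨Nat.log 2 y - D - 1, by omega, by omega⟩
  have hD : D < 2 ^ D := Nat.lt_two_pow_self
  have hq2 : q < 2 ^ q := Nat.lt_two_pow_self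
  -- `(j + 1) D ≤ 2 ^ j`
  have key : (Nat.log 2 y + 1) * D ≤ 2 ^ Nat.log 2 y := by
    rw [hjq, show 2 ^ (q + D + 1) = 2 ^ q * 2 ^ D * 2 by ring]
    nlinarith [Nat.mul_le_mul_right D hq]
  calc y ^ D ≤ (2 ^ (Nat.log 2 y + 1)) ^ D := Nat.pow_le_pow_left hylt.le D
    _ = 2 ^ ((Nat.log 2 y + 1) * D) := by rw [← pow_mul]
    _ ≤ 2 ^ 2 ^ Nat.log 2 y := Nat.pow_le_pow_right two_pos key
    _ ≤ 2 ^ y := Nat.pow_le_pow_right two_pos hjy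

/-- The bookkeeping of `stub_sparseRigid`: with `q = (L + E + 1)^{E+1}`, `16 q³ ≤ 2^L` for all
large `L`. [folklore] -/
theorem growth (E : ℕ) : ∃ L₀ : ℕ, ∀ L, L₀ ≤ L →
    16 * ((L + E + 1) ^ (E + 1) * ((L + E + 1) ^ (E + 1) * (L + E + 1) ^ (E + 1))) ≤ 2 ^ L := by
  refine ⟨2 ^ (2 * (4 * E + 8) + 3), fun L hL => ?_⟩
  set y := L + E + 1 with hy
  have hy1 : 2 ^ (2 * (4 * E + 8) + 3) ≤ y := le_trans hL (by omega)
  have h1 := pow_le_two_pow (4 * E + 8) y hy1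
  have hy2 : 2 ≤ y := by
    have : 1 ≤ 2 ^ (2 * (4 * E + 8) + 3) := Nat.one_le_two_pow
    omega
  have h2 : y ^ (E + 1) * (y ^ (E + 1) * y ^ (E + 1)) * 2 ^ (E + 5) ≤ y ^ (4 * E + 8) := by
    rw [show y ^ (4 * E + 8) = y ^ (E + 1) * (y ^ (E + 1) * y ^ (E + 1)) * y ^ (E + 5) by ring]
    exact Nat.mul_le_mul_left _ (Nat.pow_le_pow_left hy2 _)
  have h3 : 2 ^ y = 2 ^ L * 2 ^ (E + 1) := by rw [hy, Nat.add_assoc, pow_add]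
  have h4 : 16 * (y ^ (E + 1) * (y ^ (E + 1) * y ^ (E + 1))) * 2 ^ (E + 1) ≤
      2 ^ L * 2 ^ (E + 1) :=
    calc 16 * (y ^ (E + 1) * (y ^ (E + 1) * y ^ (E + 1))) * 2 ^ (E + 1)
        = y ^ (E + 1) * (y ^ (E + 1) * y ^ (E + 1)) * 2 ^ (E + 5) := by ring
      _ ≤ y ^ (4 * E + 8) := h2
      _ ≤ 2 ^ y := h1
      _ = 2 ^ L * 2 ^ (E + 1) := h3
  exact Nat.le_of_mul_le_mul_right h4 (Nat.two_pow_pos _)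

/-! ### Labelling the rows -/

/-- A labelling `BlockV b k m ≃ Fin n` (`BlockV b k m = Fin b ⊕ ((Fin b × Fin b × Fin k) ⊕ Fin m)`)
placing the core and the internal labels onto a prescribed set `R` of `b + b·(b·k)` rows (and the
padding labels onto its complement). [folklore] -/
theorem exists_blockEquiv {n : ℕ} (R : Finset (Fin n)) (b k m : ℕ)
    (hR : R.card = b + b * (b * k)) (hm : m = n - R.card) :
    ∃ eR : Fin b ⊕ ((Fin b × Fin b × Fin k) ⊕ Fin m) ≃ Fin n,
      (∀ i, eR (Sum.inl i) ∈ R) ∧ ∀ p, eR (Sum.inr (Sum.inl p)) ∈ R := by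
  classical
  have h1 : Fintype.card (Fin b ⊕ (Fin b × Fin b × Fin k)) = Fintype.card {x // x ∈ R} := by
    simp only [Fintype.card_sum, Fintype.card_fin, Fintype.card_prod, Fintype.card_coe, hR]
  have h2 : Fintype.card (Fin m) = Fintype.card {x // x ∉ R} := by
    rw [Fintype.card_fin, Fintype.card_subtype_compl, Fintype.card_fin, Fintype.card_coe, hm]
  let e₁ := Fintype.equivOfCardEq h1
  let e₂ := Fintype.equivOfCardEq h2
  refine ⟨(Equiv.sumAssoc _ _ _).symm.trans ((e₁.sumCongr e₂).trans (Equiv.sumCompl (· ∈ R))),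
    fun i => ?_, fun p => ?_⟩
  · simp [e₁]
  · simp [e₁]

/-! ### The generic weight -/

variable {n : ℕ}

/-- The generic weight of a cell set `G` in radix `B`: `W = B^{n²}` on the cells of `G` and
`W - B^{rank e}` on a cell `e ∉ G`, `rank = finProdFinEquiv`. [folklore] -/
def genericWeight (G : Finset (Fin n × Fin n)) (B : ℕ) (e : Fin n × Fin n) : ℕ :=
  if e ∈ G then B ^ (n * n) else B ^ (n * n) - B ^ (finProdFinEquiv e : ℕ)

/-- The off-`G` digit sum of an exponent vector: `Σ_{e ∉ G} B^{rank e} · m e`. [folklore] -/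
def offDigitSum (G : Finset (Fin n × Fin n)) (B : ℕ) (m : (Fin n × Fin n) →₀ ℕ) : ℕ :=
  ∑ e, (if e ∈ G then 0 else m e) * B ^ (finProdFinEquiv e : ℕ)

variable (G : Finset (Fin n × Fin n)) {B : ℕ}

/-- On `G` the generic weight is `W`. [folklore] -/
theorem genericWeight_of_mem (B : ℕ) {e : Fin n × Fin n} (he : e ∈ G) :
    genericWeight G B e = B ^ (n * n) :=
  if_pos he

/-- Off `G` the generic weight plus the place value is `W`. [folklore] -/
theorem genericWeight_add_of_notMem (hB : 0 < B) {e : Fin n × Fin n} (he : e ∉ G) :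
    genericWeight G B e + B ^ (finProdFinEquiv e : ℕ) = B ^ (n * n) := by
  rw [genericWeight, if_neg he]
  exact Nat.sub_add_cancel (Nat.pow_le_pow_right hB (finProdFinEquiv e).2.le)

/-- Off `G` the generic weight is `< W`. [folklore] -/
theorem genericWeight_lt_of_notMem (hB : 0 < B) {e : Fin n × Fin n} (he : e ∉ G) :
    genericWeight G B e < B ^ (n * n) := by
  have := genericWeight_add_of_notMem G hB he
  have : 0 < B ^ (finProdFinEquiv e : ℕ) := Nat.pow_pos hB
  omega

/-- **The generic weight cuts out `G`** (`CutsOut (genericWeight G B) G` of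
`Theorems/DivisionGapDefs.lean`, spelled out) as soon as some permutation lies inside `G`: every
permutation weighs at most `n · W`, with equality iff all its cells are in `G`. [folklore] -/
theorem cutsOut_genericWeight (hB : 0 < B) (σ₀ : Equiv.Perm (Fin n))
    (hσ₀ : ∀ x, (σ₀ x, x) ∈ G) :
    ∀ σ : Equiv.Perm (Fin n), (∀ i, (σ i, i) ∈ G) ↔
      ∀ τ : Equiv.Perm (Fin n), (∑ i, genericWeight G B (τ i, i)) ≤
        ∑ i, genericWeight G B (σ i, i) := by
  have hle : ∀ e, genericWeight G B e ≤ B ^ (n * n) := fun e =>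
    if h : e ∈ G then (genericWeight_of_mem G B h).le else (genericWeight_lt_of_notMem G hB h).le
  have hsum : ∀ τ : Equiv.Perm (Fin n), ∑ x, genericWeight G B (τ x, x) ≤ n * B ^ (n * n) :=
    fun τ => calc ∑ x, genericWeight G B (τ x, x) ≤ ∑ _x : Fin n, B ^ (n * n) :=
          Finset.sum_le_sum fun x _ => hle _
      _ = n * B ^ (n * n) := by simp
  have hin : ∀ τ : Equiv.Perm (Fin n), (∀ x, (τ x, x) ∈ G) →
      ∑ x, genericWeight G B (τ x, x) = n * B ^ (n * n) := fun τ hτ => by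
    rw [Finset.sum_congr rfl fun x _ => genericWeight_of_mem G B (hτ x)]
    simp
  intro σ
  constructor
  · intro hσ τ
    rw [hin σ hσ]
    exact hsum τ
  · intro hmax
    by_contra hno
    push Not at hno
    obtain ⟨x₀, hx₀⟩ := hno
    have hlt : ∑ x, genericWeight G B (σ x, x) < n * B ^ (n * n) :=
      calc ∑ x, genericWeight G B (σ x, x) < ∑ _x : Fin n, B ^ (n * n) :=
            Finset.sum_lt_sum (fun x _ => hle _)
              ⟨x₀, Finset.mem_univ _, genericWeight_lt_of_notMem G hB hx₀⟩
        _ = n * B ^ (n * n) := by simp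
    have := hmax σ₀
    rw [hin σ₀ hσ₀] at this
    omega

/-! ### The top fibre of the generic weight -/

/-- Weight plus off-`G` digit sum is `W · deg`. [folklore] -/
theorem weight_add_offDigitSum (hB : 0 < B) (m : (Fin n × Fin n) →₀ ℕ) :
    Finsupp.weight (genericWeight G B) m + offDigitSum G B m = B ^ (n * n) * m.degree := by
  rw [Finsupp.weight_apply, Finsupp.sum_fintype m (fun i c => c • genericWeight G B i)
    (fun _ => zero_smul _ _), offDigitSum,
    ← Finset.sum_add_distrib, Finsupp.degree_eq_sum, Finset.mul_sum]
  refine Finset.sum_congr rfl fun e _ => ?_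
  by_cases he : e ∈ G
  · rw [if_pos he, genericWeight_of_mem G B he, smul_eq_mul, zero_mul, add_zero, mul_comm]
  · rw [if_neg he, smul_eq_mul, ← mul_add, genericWeight_add_of_notMem G hB he, mul_comm]

/-- Base-`B` uniqueness off `G`: exponent vectors with digits `< B` and equal off-`G` digit sums
agree off `G`. [folklore] -/
theorem eq_offG_of_offDigitSum_eq {m₁ m₂ : (Fin n × Fin n) →₀ ℕ} (h₁ : ∀ e, m₁ e < B)
    (h₂ : ∀ e, m₂ e < B) (h : offDigitSum G B m₁ = offDigitSum G B m₂) :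
    ∀ e ∉ G, m₁ e = m₂ e := by
  set rank : Fin n × Fin n ≃ Fin (n * n) := finProdFinEquiv
  have hre : ∀ m : (Fin n × Fin n) →₀ ℕ, ∑ i : Fin (n * n),
      (if rank.symm i ∈ G then 0 else m (rank.symm i)) * B ^ (i : ℕ) = offDigitSum G B m := by
    intro m
    rw [offDigitSum, ← Equiv.sum_comp rank.symm]
    simp only [rank, Equiv.apply_symm_apply]
  have hlt : ∀ m : (Fin n × Fin n) →₀ ℕ, (∀ e, m e < B) →
      ∀ i : Fin (n * n), (if rank.symm i ∈ G then 0 else m (rank.symm i)) < B := by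
    intro m hm i
    split_ifs
    · exact Nat.zero_lt_of_lt (hm (rank.symm i))
    · exact hm _
  have key := eq_of_sum_mul_pow_eq _ _ (hlt m₁ h₁) (hlt m₂ h₂) (by rw [hre, hre, h])
  intro e he
  have := congrFun key (rank e)
  simpa [he] using this

/-- Monomials of the top component have the maximal weight. [folklore] -/
theorem weight_eq_of_mem_support_topComponent {σ : Type*} (w : σ → ℕ)
    (p : MvPolynomial σ ℝ≥0) {d : σ →₀ ℕ} (hd : d ∈ (topComponent w p).support) :
    Finsupp.weight w d = weightedTotalDegree w p := by
  have := mem_support_iff.mp hd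
  rw [coeff_topComponent] at this
  by_contra hne
  exact this (if_neg hne)

/-- Exponent vectors with the same row margins have the same degree (so torus-homogeneous
polynomials are homogeneous). [folklore] -/
theorem degree_eq_of_rowDegrees_eq {m₁ m₂ : (Fin n × Fin n) →₀ ℕ}
    (hr : rowDegrees m₁ = rowDegrees m₂) : m₁.degree = m₂.degree := by
  rw [← degree_rowDegrees, ← degree_rowDegrees, hr]

/-- **The top fibre of the generic weight agrees off `G`.**  For `B = deg h + 1`, any two
monomials of the same degree of `topComponent (genericWeight G B) h` coincide at every cell
`e ∉ G`. [folklore] -/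
theorem eq_offG_of_mem_support_topComponent {h : MvPolynomial (Fin n × Fin n) ℝ≥0}
    {m₁ m₂ : (Fin n × Fin n) →₀ ℕ}
    (hm₁ : m₁ ∈ (topComponent (genericWeight G (h.totalDegree + 1)) h).support)
    (hm₂ : m₂ ∈ (topComponent (genericWeight G (h.totalDegree + 1)) h).support)
    (hdeg : m₁.degree = m₂.degree) : ∀ e ∉ G, m₁ e = m₂ e := by
  set B := h.totalDegree + 1 with hB
  have hB0 : 0 < B := Nat.succ_pos _
  have hs₁ := support_topComponent_subset _ h hm₁
  have hs₂ := support_topComponent_subset _ h hm₂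
  have hw₁ := weight_eq_of_mem_support_topComponent _ h hm₁
  have hw₂ := weight_eq_of_mem_support_topComponent _ h hm₂
  have e₁ := weight_add_offDigitSum G hB0 m₁
  have e₂ := weight_add_offDigitSum G hB0 m₂
  have hlt : ∀ m ∈ h.support, ∀ e, m e < B := fun m hm e =>
    Nat.lt_succ_of_le ((Finsupp.le_degree e m).trans (le_totalDegree hm))
  refine eq_offG_of_offDigitSum_eq G (hlt m₁ hs₁) (hlt m₂ hs₂) ?_
  rw [hdeg] at e₁
  omega

/-! ### Margins as sums -/

/-- The margin of `mapDomain f m` at `a` is the sum of `m` over the fibre of `a`. [folklore] -/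
theorem mapDomain_apply_eq_sum (f : Fin n × Fin n → Fin n) (m : (Fin n × Fin n) →₀ ℕ) (a : Fin n) :
    Finsupp.mapDomain f m a = ∑ x, if f x = a then m x else 0 := by
  rw [Finsupp.mapDomain, Finsupp.sum_apply, Finsupp.sum_fintype _ _ (fun _ => by simp)]
  simp only [Finsupp.single_apply]

/-- Row margins as row sums. [folklore] -/
theorem rowDegrees_apply (m : (Fin n × Fin n) →₀ ℕ) (r : Fin n) :
    rowDegrees m r = ∑ c, m (r, c) := by
  rw [rowDegrees, mapDomain_apply_eq_sum, Fintype.sum_prod_type, Finset.sum_comm]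
  refine Finset.sum_congr rfl fun c _ => ?_
  rw [Finset.sum_ite_eq', if_pos (Finset.mem_univ _)]

/-- Column margins as column sums. [folklore] -/
theorem colDegrees_apply (m : (Fin n × Fin n) →₀ ℕ) (c : Fin n) :
    Finsupp.mapDomain Prod.snd m c = ∑ r, m (r, c) := by
  rw [mapDomain_apply_eq_sum, Fintype.sum_prod_type]
  refine Finset.sum_congr rfl fun r _ => ?_
  rw [Finset.sum_ite_eq' Finset.univ c (fun x => m (r, x)), if_pos (Finset.mem_univ _)]

end Summit.ValiantsHypothesis.ValiantsHypothesis.Theorems.DivisionGapPerDivisionHard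

end
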